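import Literature.IUT.HodgeTheaters.PiAvatarNFLabPull
import Literature.IUT.HodgeTheaters.PiAvatarBaseKitNFInstances
import Literature.IUT.HodgeTheaters.PiAvatarNFKitSurjective
import Literature.IUT.HodgeTheaters.KitNFSide
import HarnessLib

/-!
# THE GENUINE NF-SIDE KIT `NFKit` OF [IUTchI] §4 AT THE INITIAL Θ-DATA — the record `PMBaseKit.NFKit` over abc-iut-L5-t4's NF-widened base
# kit, EVERY field filled from landed slots, every law a THEOREM ([IUTchI] Def 4.1 (v)(vi), Ex 4.3 (i)–(iii), Ex 4.5 (i)(ii), Def 6.1 (v);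
# defs — post-freeze additive D13 assembly, row «nfKit-assembly»; not a cone member)

S. Mochizuki, *Inter-universal Teichmüller theory I*, kurims manuscript (May 2020), Def 4.1 (v) p. 97 («`𝒟^⊚ := ℬ(C̲_K)⁰` … `LabCusp(†𝒟^⊚)` …
admits a natural `𝔽_l^⋇`-torsor structure … `𝕍(†𝒟^⊚)`»), (vi) p. 97 («a poly-morphism `†𝒟_v → †𝒟^⊚`»), Ex 4.3 (i)–(iii) pp. 98–100 (`Aut_ε̲(C̲_K)`,
`Aut(C̲_K)/Aut_ε̲(C̲_K) ⥲ 𝔽_l^⋇`, `φ^NF_{•,v}`), Ex 4.5 (i)(ii) pp. 107–108 (`LabCusp(𝒟^⊚) ⥲ LabCusp(𝒟_{v̲})`, `[ε] ↦ η_v`), Def 6.1 (v) p. 158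
(«a finite étale double covering `𝒟^{⊚±} → 𝒟^⊚`») ([IUTchI] Def 4.1 (v) p.97) [claim: Mochizuki2012, status: disputed] (D-0012 claim key, series status
DISPUTED — a CONSTRUCTION over abc-iut-L5-t2's REAL `InitialThetaData`, abc-iut-L5-t1's `CuspGalois`, abc-iut-L5-t4's binders and kits; nothing of
the series is asserted, no side is taken on [IUTchIII] Cor. 3.12).

WHAT (abc-iut-L5-t3 = single writer of the NF-side kit, L5-lead RULINGS #31/#43/#46/#57 (1)/#67 (3); NFKIT-INSTANCE-MAP v3).  The hypothesis structure
`PMBaseKit.NFKit K` (KitNFSide, p428169) is INSTANTIATED at abc-iut-L5-t4's NF-widened base kit (J-NF-1: `baseKitNFOfData`, p450158; `baseKitNF`,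
`baseKitNFOfBadPairs`, `baseKitNFStandIn`, p450281), field by field, from landed slots:
* `GlobNF`/`gnfModel`/`gnf_iso` — the isomorphs of `𝒟^⊚` (PiAvatarNFSide, p427697); `nfAtV := nfAtVNF`, `projAt := projAtNF` (abc-iut-L5-t4, p450158),
  `phiNF := phiNFNF` (`φ^NF_{•,v̲}` of PiAvatarNFLabPull), **law `phiNF_eq` := `phiNFAmb_eq`** (`φ^NF = φ^{Θell} ≫ (𝒟^{⊚±} → 𝒟^⊚)`, every index);
* `Val := Shrink (Val K)` — `𝕍(†𝒟^⊚) = 𝕍(K)`, all places of `K` (abc-iut-L5-t2's ruling; `Type 0` copy of the countable `Val K`), `valIso := refl`,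
  `valOfV :=` the kit's index ↪ `Val K` (at `V̲`: `indexCopyVal`);
* `GLabNF := 𝔽_l^⋇`, `gLabNFMap := gLabNFMapSlot` with its laws, `εLab := 1` (PiAvatarNFKitSlots, p437019), **law `exists_aut_smul`** from the
  surjectivity of `toFlStarNF` (`exists_aut_smul_iff_surjective`; = `toFlStarNF_surjective_of_torsionMonodromy M`, p437719);
* `LabStar := 𝔽_l^⋇`, `labStarIso := refl`, `ηStar := 1` (Prop 4.2 / Def 4.1 (ii) canonical readings) — laws `rfl`;
* **`labPull f := labPullAmb f.hom`** with the laws `labPull_smul/_pre/_post/labPull_phiNF_εLab` := `labPullAmb_smul/_pre/_post/_phiNFAmb_one`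
  (PiAvatarNFLabPull, p450993; Ex 4.5 (i)(ii)).
Results: **`nfKitOfData`** (any index set and `δ`-family, binder `hNF : Surjective toFlStarNF`), **`nfKit`** (over `V̲`, `valOfV := indexCopyVal`),
**`nfKitOfBadPairs`** (`hNF` DISCHARGED from `M : TorsionMonodromy`), **`nfKitStandIn`** (at the `X̲→`-stand-in kit; «[`X̲→`-profinite stand-in at
`v̲ ∈ V̲^bad`]»).  BINDERS, exhaustively: those of the base kit (`CG`, `hS`, `M`/`[Normal]`+`hsurj`, `hA`, `hI`, `B`/`ΛBad`) and NOTHING ELSE on the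
NF side.  With it `BaseThetaDatum.ofKitCore` (KitNFSideDatum) becomes available at genuine data (row «KITCORE-AT-GENUINE-KIT», next).
No instance, no notation; typed ≠ inhabited ≠ proved; binder ≠ fact; a stand-in kit witnesses the consistency of OUR binders only.
-/

noncomputable section

namespace Literature.IUT.HodgeTheaters

open CategoryTheory

universe u v w

/-! ### A `Type 0` copy of the places of a number field -/

section CountableVal

variable (F : Type u) [Field F] [NumberField F]

/-- (plumbing) A number field has countably many ideals in its ring of integers (Noetherian: finitely generated; `𝓞 F` countable). [folklore] -/
private theorem countable_ideal_ringOfIntegers_nf : Countable (Ideal (NumberField.RingOfIntegers F)) := by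
  haveI : Countable F := Countable.of_equiv _ (Module.finBasis ℚ F).equivFun.toEquiv.symm
  haveI : Countable (NumberField.RingOfIntegers F) := Subtype.countable
  have h : ∀ I : Ideal (NumberField.RingOfIntegers F), ∃ s : Finset (NumberField.RingOfIntegers F),
      Ideal.span (s : Set _) = I := fun I => IsNoetherian.noetherian I
  choose gen hgen using h
  have hinj : Function.Injective gen := fun I J hIJ => by rw [← hgen I, ← hgen J, hIJ]
  exact hinj.countable

/-- (plumbing) A number field has countably many places. [folklore] -/
private theorem countable_val_nf : Countable (Val F) := by
  haveI := countable_ideal_ringOfIntegers_nf F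
  haveI : Countable (IsDedekindDomain.HeightOneSpectrum (NumberField.RingOfIntegers F)) :=
    Function.Injective.countable
      (f := fun v : IsDedekindDomain.HeightOneSpectrum (NumberField.RingOfIntegers F) => v.asIdeal)
      fun _ _ h => IsDedekindDomain.HeightOneSpectrum.ext h
  haveI : Countable (NumberField.FinitePlace F) :=
    Function.Injective.countable (NumberField.FinitePlace.maximalIdeal_injective (K := F))
  unfold Val
  infer_instance

/-- `𝕍(F)` (all places of a number field, [IUTchI] §0 «Numbers» p. 35: `𝕍(F) = 𝕍(F)^arc ∪ 𝕍(F)^non`) is countable, hence has a copy in `Type 0` —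
the universe of the NF-kit slot `Val` (a theorem, not an instance). ([IUTchI] Def 4.1 (v) p.97) [claim: Mochizuki2012, status: disputed] -/
theorem small_val (F : Type u) [Field F] [NumberField F] : Small.{0} (Val F) := by
  haveI := countable_val_nf F
  infer_instance

end CountableVal

section NFKitAssembly

variable {F : Type u} {K : Type v} {Fbar : Type w} [Field F] [NumberField F] [Field K] [NumberField K]
  [Algebra F K] [Field Fbar] [Algebra F Fbar] [Algebra K Fbar]
  {E : WeierstrassCurve F} [E.IsElliptic] {l : ℕ} {Pb : BadPlacePredicates K}
  (D : InitialThetaData F K Fbar E l Pb) (CG : D.geom.pe.CuspGalois) (hS : D.CuspClassesNormaliserStable) [Fact l.Prime]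

namespace InitialThetaData

namespace LocalDatum

variable {D CG hS} (δ : D.LocalDatum CG hS)

/-- **NF-kit slot `phiNF v` at a local datum**: `φ^NF_{•,v̲} : 𝒟_v̲ → 𝒟^⊚` (`xΠ_v̲ ↦ xΠ_{C̲_K}`, PiAvatarNFLabPull `phiNFAmb`) as a morphism of the
NF-widened ambient `AmbNF` into `†𝒟^⊚` seen at `v̲` (abc-iut-L5-t4's `nfAtVNF`). ([IUTchI] Ex 4.3 (ii) p.99) [claim: Mochizuki2012, status: disputed] -/
def phiNFNF : δ.modelNF ⟶ (δ.nfAtVNF).obj D.gnfModel := ObjectProperty.homMk δ.phiNFAmb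

/-- Its underlying ambient morphism is `phiNFAmb`. ([IUTchI] Ex 4.3 (ii) p.99) [claim: Mochizuki2012, status: disputed] -/
theorem phiNFNF_hom : (δ.phiNFNF).hom = δ.phiNFAmb := rfl

/-- **NF-kit law `phiNF_eq` at a local datum**, in the NF-widened ambient: `φ^NF_{•,v̲} = φ^{Θell}_{•,v̲} ≫ (𝒟^{⊚±} → 𝒟^⊚)`.
([IUTchI] Def 6.1 (v) p.158) [claim: Mochizuki2012, status: disputed] -/
theorem phiNFNF_eq : δ.phiNFNF = δ.phiEllNF ≫ δ.projAtNF := InducedCategory.hom_ext δ.phiNFAmb_eq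

/-- An object of the local full subcategory `LocalObj v` of the NF-widened kit is an isomorph of `𝒟_v̲` in the ambient.
([IUTchI] Def 4.1 (i) p.95) [claim: Mochizuki2012, status: disputed] -/
theorem nonempty_iso_locObj_of_nonempty_iso_modelNF {X : δ.AmbNF} (hX : Nonempty (X ≅ δ.modelNF)) : Nonempty (X.obj ≅ δ.locObj) :=
  ⟨((δ.InPlayNF).ι).mapIso hX.some⟩

end LocalDatum

/-! ### The NF kit over a `δ`-family (any index set) -/

section OfData

variable [(D.PiXund.subgroupOf D.PiXK).Normal] (hsurj : Function.Surjective D.toFlStarGlobal)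
  {V : Type} [DecidableEq V] (bad arc : Finset V) (δ : V → D.LocalDatum CG hS)

/-- **THE NF KIT over abc-iut-L5-t4's `baseKitNFOfData`** — every field of `PMBaseKit.NFKit` (KitNFSide) filled from landed slots; binders: the base
kit's, `hNF : Surjective toFlStarNF` (Ex 4.3 (i) surjectivity; = `toFlStarNF_surjective_of_torsionMonodromy M`) and an embedding of the index set into
the places of `K` (for `valOfV`). ([IUTchI] Def 4.1 (v) p.97) [claim: Mochizuki2012, status: disputed] -/
def nfKitOfData (hNF : Function.Surjective (D.toFlStarNF CG hS)) (vemb : V ↪ Val K) :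
    (D.baseKitNFOfData CG hS hsurj bad arc δ).NFKit where
  GlobNF := D.GlobNF
  gnfModel := D.gnfModel
  gnf_iso := D.gnf_iso
  nfAtV v := (δ v).nfAtVNF
  projAt v := (δ v).projAtNF
  phiNF v := (δ v).phiNFNF
  phiNF_eq v := (δ v).phiNFNF_eq
  Val _ := @Shrink.{0} (Val K) (small_val K)
  valIso _ := Equiv.refl _
  valIso_refl _ := rfl
  valIso_trans _ _ := rfl
  valOfV := ⟨fun x => (@equivShrink (Val K) (small_val K)) (vemb x),
    (@equivShrink (Val K) (small_val K)).injective.comp vemb.injective⟩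
  GLabNF _ := FlStar l
  isTorsor_gLabNF _ := IsTorsor.self
  gLabNFMap b := D.gLabNFMapSlot CG hS b
  gLabNFMap_smul b j c := D.gLabNFMapSlot_smul CG hS b j c
  gLabNFMap_refl Y := D.gLabNFMapSlot_refl CG hS Y
  gLabNFMap_trans b b' := D.gLabNFMapSlot_trans CG hS b b'
  εLab := 1
  exists_aut_smul := (D.exists_aut_smul_iff_surjective CG hS).mpr hNF
  LabStar _ _ := FlStar l
  isTorsor_labStar _ _ := IsTorsor.self
  labStarIso _ := Equiv.refl _
  labStarIso_smul _ _ _ := rfl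
  labStarIso_refl _ := rfl
  labStarIso_trans _ _ := rfl
  ηStar _ _ := 1
  labStarIso_η _ := rfl
  labPull := fun {v} {_X} {_Y} f => (δ v).labPullAmb f.hom
  labPull_smul := fun {v} {_X} {_Y} f j c => (δ v).labPullAmb_smul f.hom j c
  labPull_pre := fun {v} {X} {_X'} {_Y} a f c =>
    (δ v).labPullAmb_pre ((δ v).nonempty_iso_locObj_of_nonempty_iso_modelNF X.property)
      (((δ v).InPlayNF).ι.mapIso ((ObjectProperty.ι _).mapIso a)) f.hom c
  labPull_post := fun {v} {X} {_Y} {_Y'} f b c =>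
    (δ v).labPullAmb_post ((δ v).nonempty_iso_locObj_of_nonempty_iso_modelNF X.property) f.hom b c
  labPull_phiNF_εLab v := (δ v).labPullAmb_phiNFAmb_one

/-- The NF kit's isomorphs of `𝒟^⊚` are abc-iut-L5-t3's `GlobNF`. ([IUTchI] Def 4.1 (v) p.97) [claim: Mochizuki2012, status: disputed] -/
theorem nfKitOfData_GlobNF (hNF : Function.Surjective (D.toFlStarNF CG hS)) (vemb : V ↪ Val K) :
    (D.nfKitOfData CG hS hsurj bad arc δ hNF vemb).GlobNF = D.GlobNF := rfl

/-- `φ^NF_{•,v̲}` of the NF kit is `xΠ_v̲ ↦ xΠ_{C̲_K}`. ([IUTchI] Ex 4.3 (ii) p.99) [claim: Mochizuki2012, status: disputed] -/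
theorem nfKitOfData_phiNF_hom (hNF : Function.Surjective (D.toFlStarNF CG hS)) (vemb : V ↪ Val K) (v : V) :
    ((D.nfKitOfData CG hS hsurj bad arc δ hNF vemb).phiNF v).hom = (δ v).phiNFAmb := rfl

/-- The label classes of the NF kit are the canonical labels `𝔽_l^⋇` (Prop 4.2). ([IUTchI] Prop 4.2 p.98) [claim: Mochizuki2012, status: disputed] -/
theorem nfKitOfData_GLabNF (hNF : Function.Surjective (D.toFlStarNF CG hS)) (vemb : V ↪ Val K)
    (Y : (D.nfKitOfData CG hS hsurj bad arc δ hNF vemb).GlobNF) :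
    (D.nfKitOfData CG hS hsurj bad arc δ hNF vemb).GLabNF Y = FlStar l := rfl

/-- `[ε] = 1` in the NF kit. ([IUTchI] Ex 4.5 (ii) p.108) [claim: Mochizuki2012, status: disputed] -/
theorem nfKitOfData_εLab (hNF : Function.Surjective (D.toFlStarNF CG hS)) (vemb : V ↪ Val K) :
    (D.nfKitOfData CG hS hsurj bad arc δ hNF vemb).εLab = (1 : FlStar l) := rfl

/-- The label pull-back of the NF kit is multiplication by `labPullChar`. ([IUTchI] Ex 4.5 (i) p.107) [claim: Mochizuki2012, status: disputed] -/
theorem nfKitOfData_labPull_apply (hNF : Function.Surjective (D.toFlStarNF CG hS)) (vemb : V ↪ Val K) {v : V}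
    {X : (D.baseKitNFOfData CG hS hsurj bad arc δ).LocalObj v} {Y : (D.nfKitOfData CG hS hsurj bad arc δ hNF vemb).GlobNF}
    (f : X.obj ⟶ ((D.nfKitOfData CG hS hsurj bad arc δ hNF vemb).nfAtV v).obj Y) (c : FlStar l) :
    (D.nfKitOfData CG hS hsurj bad arc δ hNF vemb).labPull f c = (δ v).labPullChar f.hom * c := rfl

end OfData

/-! ### The NF kit over `V̲` and at the genuine-shape / stand-in kits -/

section OverPlaces

variable [(D.PiXund.subgroupOf D.PiXK).Normal] (hsurj : Function.Surjective D.toFlStarGlobal) (hA : D.geom.pe.ArrowCoveringClaims)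
  (B : ∀ v, v ∈ D.indexCopyBad → D.BadPairAt v) (Λ : ∀ v, D.LocalArrowLaw CG hS (D.localGroupAt B v))

/-- The embedding of the index copy of `V̲` into the places of `K` (`valOfV`: «`V̲ ⊆ 𝕍(K)`», Def 3.1 (e)). ([IUTchI] Def 3.1 (e) p.62) [claim: Mochizuki2012, status: disputed] -/
def indexCopyValEmb : D.IndexCopy ↪ Val K := ⟨D.indexCopyVal, D.indexCopyVal_injective⟩

open Classical in
/-- **THE NF KIT OF THE INITIAL Θ-DATA OVER `V̲`** (over abc-iut-L5-t4's `baseKitNF`, p450281), binder `hNF : Surjective toFlStarNF`.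
([IUTchI] Def 4.1 (v) p.97) [claim: Mochizuki2012, status: disputed] -/
def nfKit (hNF : Function.Surjective (D.toFlStarNF CG hS)) : (D.baseKitNF B CG hS hsurj hA Λ).NFKit :=
  D.nfKitOfData CG hS hsurj D.indexCopyBad D.indexCopyArc (D.localDatumAt B CG hS hA Λ) hNF D.indexCopyValEmb

end OverPlaces

section Genuine

variable (M : D.TorsionMonodromy) (hA : D.geom.pe.ArrowCoveringClaims)
  (hI : ∀ k ∈ D.geom.pe.inertia D.geom.pe.ε1, M.tau (D.geom.embK k) = 0)
  (B : ∀ v, v ∈ D.indexCopyBad → D.BadPairAt v) (ΛBad : ∀ v (h : v ∈ D.indexCopyBad), D.LocalArrowLaw CG hS (B v h).H)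

/-- **THE NF KIT AT THE GENUINE-SHAPE BASE KIT `baseKitNFOfBadPairs`** — `hNF` DISCHARGED from the torsion-monodromy datum
(`toFlStarNF_surjective_of_torsionMonodromy`, p437719): NO binder beyond the base kit's {`CG`, `hS`, `M`, `hA`, `hI`, `B`, `ΛBad`}.
([IUTchI] Def 4.1 (v) p.97) [claim: Mochizuki2012, status: disputed] -/
def nfKitOfBadPairs : (D.baseKitNFOfBadPairs CG hS M hA hI B ΛBad).NFKit :=
  haveI := M.normal_PiXund_subgroupOf_PiXK
  D.nfKit CG hS (D.toFlStarGlobal_surjective_of_torsionMonodromy M) hA B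
    (D.localArrowLawFamilyOfTorsionMonodromy CG hS M hA hI B
      (fun v _ => D.localArrowLaw_L2_sign_local CG hS hA (D.decompAt v)) ΛBad)
    (D.toFlStarNF_surjective_of_torsionMonodromy CG hS M)

/-- **THE NF KIT AT THE `X̲→`-STAND-IN BASE KIT `baseKitNFStandIn`** («[`X̲→`-profinite stand-in at `v̲ ∈ V̲^bad`]»: NOT print's tempered
`ℬ^temp(X̳_v̲)⁰`; binders {`CG`, `hS`, `M`, `hA`, `hI`}). ([IUTchI] Def 4.1 (v) p.97) [claim: Mochizuki2012, status: disputed] -/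
def nfKitStandIn : (D.baseKitNFStandIn CG hS M hA hI).NFKit :=
  D.nfKitOfBadPairs CG hS M hA hI (fun v _ => D.badPairAtArrow hA v)
    (fun v _ => D.localArrowLaw_local_of_torsionMonodromy CG hS M hA hI (D.decompAt v))

/-- `[ε] = 1` in the stand-in NF kit (KIT RULE: the NF-side laws FIRE at closed data). ([IUTchI] Ex 4.5 (ii) p.108) [claim: Mochizuki2012, status: disputed] -/
theorem nfKitStandIn_εLab : (D.nfKitStandIn CG hS M hA hI).εLab = (1 : FlStar l) := rfl

/-- Non-vacuity of the hypothesis structure `NFKit` at the stand-in base kit of the REAL initial Θ-data.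
([IUTchI] Def 4.1 (v) p.97) [claim: Mochizuki2012, status: disputed] -/
theorem nonempty_nfKit_baseKitNFStandIn : Nonempty (D.baseKitNFStandIn CG hS M hA hI).NFKit := ⟨D.nfKitStandIn CG hS M hA hI⟩

end Genuine

end InitialThetaData

end NFKitAssembly

end Literature.IUT.HodgeTheaters
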